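import Mathlib
import Summits.ValiantsHypothesis.ValiantsHypothesis.Theses.LiouvilleSarnak
import Summits.ValiantsHypothesis.ValiantsHypothesis.Theorems.LiouvilleSarnakLiouvilleCutRankBlockEntropy
import Literature.NumberTheory.Sieve.ParityWave0
import Literature.NumberTheory.Multiplicative.SquarefreeDensity

/-!
# Route LiouvilleSarnak — crux `LiouvilleCutRank` (stmt-ValiantsHypothesis-14775):
# SARNAK'S CONJECTURE IMPLIES THE CRUX

`Theorems/LiouvilleSarnakLiouvilleCutRankBlockEntropy.lean` proved
`liouvilleCutRank_of_patternEntropy`: positive sign-pattern entropy of the Liouville sequence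
(`∃ η > 0`: `≥ 2^{η L}` distinct patterns `(λ(m+1), …, λ(m+L))` for all large `L`) implies the crux
`LiouvilleCutRank`.  This file derives that hypothesis from the tree's NAMED conjecture
`Literature.NumberTheory.Sieve.SarnakConjecture` (Sarnak 2010, Möbius disjointness: for every compact
metric `X`, continuous `T : X → X` with `Dynamics.coverEntropy T univ = 0`, `f ∈ C(X, ℂ)`, `x ∈ X`,
`(1/N) Σ_{n<N} μ(n) f(Tⁿ x) → 0`):

* §1 the one-sided shift `T₀ y = y(· + 1)` on `ℕ → Bool`, the point `x_λ = (λ(i) = 1)_i` and its orbit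
  closure `F` (closed, `T₀`-invariant); every window of a point of `F` is a window of `x_λ`.
* §2 `coverEntropy_orbitClosure_le_zero`: if for every `η > 0` there are arbitrarily long `L` at
  which the windows of `x_λ` of length `L` are covered by `< 2^{η L}` patterns, then
  `coverEntropy T₀ F ≤ 0` (one orbit point per occurring `(n+k)`-window is an `(n, U_k)`-dynamical
  cover, `U_k = {agree on [0, k)}`; the `U_k` are a base of the product uniformity; Mathlib's
  `coverEntropyEntourage_le_log_coverMincard_div`).
* §3 ★ `patternEntropy_of_sarnak`: `SarnakConjecture →` positive sign-pattern entropy of `λ` — else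
  §2 makes `(F, T₀)` a zero-entropy system (metric `PiNat.metricSpaceOfDiscreteUniformity`, whose
  uniformity is the product one), and Sarnak's conjecture at the point `x_λ` with `f(y) = ±1`
  according to `y 0` gives `(1/N) Σ_{n<N} μ(n) λ(n) → 0`; but `μ λ = μ² = 𝟙_{squarefree}` has
  density `6/π² ≠ 0` (tree: `SquarefreeDensity.thm333_density`, Hardy–Wright Thm 333).
  ★★ `liouvilleCutRank_of_sarnak : SarnakConjecture → LiouvilleCutRank`.

Placement: the tree's bridge was Chowla ⇒ crux (`LiouvilleCutRankChowla.liouvilleCutRank_of_chowla`);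
Chowla ⇒ Sarnak is the tree's `sarnakConjecture_of_moebiusChowlaConjecture_holds`, so this hypothesis is
WEAKER ("`λ` is not deterministic" is all that is used).  Honest framing: conditional on an OPEN named
conjecture; `LiouvilleCutRank`, `DigitalBilinearLiouville`, `AlgebraicSarnak` stay OPEN; nothing here bears
on VP versus VNP.  No definitions (shift, point and orbit closure are written out verbatim).
-/

-- the directory `ValiantsHypothesis/ValiantsHypothesis` repeats the summit name (tree layout)
set_option linter.dupNamespace false

namespace Summit.ValiantsHypothesis.ValiantsHypothesis.Theorems.LiouvilleSarnakLiouvilleCutRank.SarnakBridge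

open Finset ArithmeticFunction Filter Topology Dynamics
open scoped Uniformity SetRel ArithmeticFunction.Moebius

open Summit.ValiantsHypothesis.ValiantsHypothesis.Theses.LiouvilleSarnak (LiouvilleCutRank)
open Summit.ValiantsHypothesis.ValiantsHypothesis.Theorems.LiouvilleSarnakLiouvilleCutRank.BlockEntropy
  (liouvilleCutRank_of_patternEntropy)

/-! ### §1 The one-sided shift and the orbit closure of the Liouville sign sequence -/

/-- Iterates of the one-sided shift: `(T₀ⁿ y)(i) = y(i + n)`. [folklore] -/
theorem shift_iterate_apply (y : ℕ → Bool) (n i : ℕ) :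
    ((fun (z : ℕ → Bool) (j : ℕ) => z (j + 1))^[n] y) i = y (i + n) := by
  induction n generalizing i with
  | zero => simp
  | succ n ih =>
    rw [Function.iterate_succ_apply', ih]
    simp only [Nat.add_assoc, Nat.add_comm 1 n]

/-- Every finite window of a point of the orbit closure of `x_λ = (λ(i) = 1)_i` under the shift is a
window of `x_λ` (cylinders are open). [folklore] -/
theorem exists_window_eq_of_mem_closure {y : ℕ → Bool}
    (hy : y ∈ closure (Set.range fun m : ℕ => fun i : ℕ => decide (liouville (m + i) = 1)))
    (L : ℕ) : ∃ m : ℕ, ∀ j < L, y j = decide (liouville (m + j) = 1) := by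
  have hopen : IsOpen {z : ℕ → Bool | ∀ j < L, z j = y j} := by
    have hset : {z : ℕ → Bool | ∀ j < L, z j = y j} =
        ⋂ j ∈ Finset.range L, (fun z : ℕ → Bool => z j) ⁻¹' {y j} := by
      ext z; simp [Finset.mem_range]
    rw [hset]
    exact isOpen_biInter_finset fun j _ =>
      (continuous_apply j).isOpen_preimage _ (isOpen_discrete _)
  obtain ⟨z, hzo, m, rfl⟩ := mem_closure_iff.mp hy _ hopen (fun j _ => rfl)
  exact ⟨m, fun j hj => (hzo j hj).symm⟩

/-- The shift maps the orbit closure of `x_λ` into itself. [folklore] -/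
theorem mapsTo_shift_orbitClosure :
    Set.MapsTo (fun (z : ℕ → Bool) (j : ℕ) => z (j + 1))
      (closure (Set.range fun m : ℕ => fun i : ℕ => decide (liouville (m + i) = 1)))
      (closure (Set.range fun m : ℕ => fun i : ℕ => decide (liouville (m + i) = 1))) := by
  have hcont : Continuous (fun (z : ℕ → Bool) (j : ℕ) => z (j + 1)) :=
    continuous_pi fun j => continuous_apply (j + 1)
  refine Set.MapsTo.closure ?_ hcont
  rintro _ ⟨m, rfl⟩
  refine ⟨m + 1, ?_⟩
  funext i
  simp only [Nat.add_right_comm m 1 i, Nat.add_assoc]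

/-! ### §2 Few windows ⇒ zero topological entropy of the orbit closure -/

/-- Every entourage of the product uniformity on `ℕ → Bool` contains a cylinder relation
`U_k = {(x, y) | ∀ i < k, x i = y i}`. [folklore] -/
theorem exists_cylinderRel_subset {U : Set ((ℕ → Bool) × (ℕ → Bool))} (hU : U ∈ 𝓤 (ℕ → Bool)) :
    ∃ k : ℕ, {p : (ℕ → Bool) × (ℕ → Bool) | ∀ i < k, p.1 i = p.2 i} ⊆ U := by
  rw [Pi.uniformity] at hU
  obtain ⟨I, hI, V, hV, hVuniv, -, hUeq⟩ := Filter.mem_iInf'.mp hU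
  obtain ⟨k, hk⟩ := hI.bddAbove
  refine ⟨k + 1, fun p hp => ?_⟩
  rw [hUeq, Set.mem_iInter]
  intro i
  by_cases hi : i ∈ I
  · have hVi := hV i
    rw [Filter.mem_comap] at hVi
    obtain ⟨t, ht, hsub⟩ := hVi
    have hbot : (𝓤 Bool) = 𝓟 SetRel.id := rfl
    rw [hbot, Filter.mem_principal] at ht
    apply hsub
    rw [Set.mem_preimage]
    apply ht
    show p.1 i = p.2 i
    exact hp i (Nat.lt_succ_of_le (hk hi))
  · rw [hVuniv i hi]
    exact Set.mem_univ _

/-- **Dynamical covers from windows.**  If a finite set `S` of Boolean `(n+k)`-patterns contains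
every window `(x_λ(m), …, x_λ(m+n+k-1))` of the Liouville sign sequence, then `S.card` bounds the least
cardinality of an `(n, U_k)`-dynamical cover of the orbit closure, `U_k = {agree on [0, k)}`: one
orbit point per window in `S` shadows every point of the closure for `n` steps. [folklore] -/
theorem coverMincard_shift_orbitClosure_le (k n : ℕ) (S : Finset (Fin (n + k) → Bool))
    (hS : ∀ m : ℕ, (fun j : Fin (n + k) => decide (liouville (m + j) = 1)) ∈ S) :
    coverMincard (fun (z : ℕ → Bool) (j : ℕ) => z (j + 1))
      (closure (Set.range fun m : ℕ => fun i : ℕ => decide (liouville (m + i) = 1)))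
      {p : (ℕ → Bool) × (ℕ → Bool) | ∀ i < k, p.1 i = p.2 i} n ≤ S.card := by
  classical
  -- one orbit point per pattern of `S` that occurs as a window
  let g : (Fin (n + k) → Bool) → (ℕ → Bool) := fun w =>
    if h : ∃ m : ℕ, (fun j : Fin (n + k) => decide (liouville (m + j) = 1)) = w
    then fun i => decide (liouville (Classical.choose h + i) = 1) else fun _ => false
  have hcover : IsDynCoverOf (fun (z : ℕ → Bool) (j : ℕ) => z (j + 1))
      (closure (Set.range fun m : ℕ => fun i : ℕ => decide (liouville (m + i) = 1)))
      {p : (ℕ → Bool) × (ℕ → Bool) | ∀ i < k, p.1 i = p.2 i} n ↑(S.image g) := by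
    intro y hy
    obtain ⟨m, hm⟩ := exists_window_eq_of_mem_closure hy (n + k)
    have hex : ∃ m' : ℕ, (fun j : Fin (n + k) => decide (liouville (m' + j) = 1)) =
        fun j : Fin (n + k) => decide (liouville (m + j) = 1) := ⟨m, rfl⟩
    refine ⟨g (fun j : Fin (n + k) => decide (liouville (m + j) = 1)),
      Finset.mem_coe.mpr (Finset.mem_image_of_mem g (hS m)), ?_⟩
    rw [mem_dynEntourage]
    intro t ht i hi
    dsimp only
    rw [shift_iterate_apply, shift_iterate_apply]
    have hit : i + t < n + k := by omega
    have h3 := congrFun (Classical.choose_spec hex) ⟨i + t, hit⟩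
    simp only at h3
    rw [hm (i + t) hit, show g (fun j : Fin (n + k) => decide (liouville (m + j) = 1)) (i + t) =
        decide (liouville (Classical.choose hex + (i + t)) = 1) by simp only [g, dif_pos hex], h3]
  calc coverMincard _ _ _ n ≤ ((S.image g).card : ℕ∞) := hcover.coverMincard_le_card
    _ ≤ (S.card : ℕ∞) := by exact_mod_cast Finset.card_image_le

/-- **Few windows ⇒ zero entropy at every cylinder scale.**  If for every `η > 0` there are arbitrarily
long `L` at which fewer than `2^{η L}` Boolean patterns cover all `L`-windows of the Liouville sign
sequence, then the cover entropy of the shift on the orbit closure at the entourage `U_k` is `≤ 0` for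
every `k`: with `L = n + k ≥ 2k + 1`, Mathlib's `coverEntropyEntourage_le_log_coverMincard_div` and
`coverMincard_shift_orbitClosure_le` give `h_{U_k} ≤ log(2^{ηL})/n ≤ 2η`. [folklore] -/
theorem coverEntropyEntourage_cylinder_le_zero (k : ℕ)
    (h : ∀ η : ℝ, 0 < η → ∀ L₀ : ℕ, ∃ L : ℕ, L₀ ≤ L ∧ ∃ S : Finset (Fin L → Bool),
      (∀ m : ℕ, (fun j : Fin L => decide (liouville (m + j) = 1)) ∈ S) ∧
        (S.card : ℝ) < (2 : ℝ) ^ (η * L)) :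
    coverEntropyEntourage (fun (z : ℕ → Bool) (j : ℕ) => z (j + 1))
      (closure (Set.range fun m : ℕ => fun i : ℕ => decide (liouville (m + i) = 1)))
      {p : (ℕ → Bool) × (ℕ → Bool) | ∀ i < k, p.1 i = p.2 i} ≤ 0 := by
  classical
  set T₀ : (ℕ → Bool) → ℕ → Bool := fun (z : ℕ → Bool) (j : ℕ) => z (j + 1)
  set F : Set (ℕ → Bool) := closure (Set.range fun m : ℕ => fun i : ℕ => decide (liouville (m + i) = 1))
  set U : SetRel (ℕ → Bool) (ℕ → Bool) := {p : (ℕ → Bool) × (ℕ → Bool) | ∀ i < k, p.1 i = p.2 i}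
  haveI : U.IsSymm := ⟨fun _ _ hxy i hi => (hxy i hi).symm⟩
  have hUU : U ○ U = U := by
    ext ⟨x, y⟩
    rw [SetRel.mem_comp]
    exact ⟨fun ⟨z, h1, h2⟩ i hi => (h1 i hi).trans (h2 i hi), fun hxy => ⟨x, fun i _ => rfl, hxy⟩⟩
  have hmaps : Set.MapsTo T₀ F F := mapsTo_shift_orbitClosure
  by_contra hpos
  push Not at hpos
  obtain ⟨ε, hε0, hεh⟩ := EReal.lt_iff_exists_real_btwn.mp hpos
  have hε : (0 : ℝ) < ε := EReal.coe_pos.mp hε0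
  obtain ⟨L, hL, S, hS, hcard⟩ := h (ε / 2) (by positivity) (2 * k + 1)
  obtain ⟨n, rfl⟩ : ∃ n, L = n + k := ⟨L - k, by omega⟩
  have hn : n ≠ 0 := by omega
  have hkn : k ≤ n := by omega
  have hle := coverEntropyEntourage_le_log_coverMincard_div (T := T₀) (F := F) (U := U) (n := n)
    hmaps hn
  rw [hUU] at hle
  have hcm := coverMincard_shift_orbitClosure_le k n S hS
  have hS0 : S.card ≠ 0 := Finset.card_ne_zero.mpr ⟨_, hS 0⟩
  have hlog : ENNReal.log ((coverMincard T₀ F U n : ℕ∞) : ENNReal) ≤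
      ((Real.log (S.card : ℝ) : ℝ) : EReal) := by
    have h1 : ((coverMincard T₀ F U n : ℕ∞) : ENNReal) ≤ ((S.card : ℕ∞) : ENNReal) :=
      ENat.toENNReal_mono hcm
    refine (ENNReal.log_monotone h1).trans (le_of_eq ?_)
    rw [ENat.toENNReal_coe, ENNReal.log_pos_real (Nat.cast_ne_zero.2 hS0) (ENNReal.natCast_ne_top _),
      ENNReal.toReal_natCast]
  have hdiv : ENNReal.log ((coverMincard T₀ F U n : ℕ∞) : ENNReal) / (n : EReal) ≤
      ((Real.log (S.card : ℝ) / n : ℝ) : EReal) := by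
    rw [EReal.coe_div, EReal.coe_coe_eq_natCast]
    exact EReal.monotone_div_right_of_nonneg (by positivity) hlog
  -- the real estimate `log #S / n < ε`
  have hreal : Real.log (S.card : ℝ) / n < ε := by
    have hSpos : (0 : ℝ) < S.card := by exact_mod_cast Nat.pos_of_ne_zero hS0
    have hlt : Real.log (S.card : ℝ) < ε / 2 * ((n + k : ℕ) : ℝ) * Real.log 2 := by
      have := Real.log_lt_log hSpos hcard
      rwa [Real.log_rpow two_pos] at this
    have hlog2 : Real.log 2 < 1 := by linarith [Real.log_two_lt_d9]
    have hnk : ((n + k : ℕ) : ℝ) ≤ 2 * n := by push_cast; exact_mod_cast (by omega : n + k ≤ 2 * n)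
    have hnn : (0 : ℝ) < n := by exact_mod_cast Nat.pos_of_ne_zero hn
    have hA : 0 ≤ ε / 2 * ((n + k : ℕ) : ℝ) := by positivity
    have h3 : ε / 2 * ((n + k : ℕ) : ℝ) * Real.log 2 ≤ ε / 2 * (2 * n) * 1 :=
      (mul_le_mul_of_nonneg_left hlog2.le hA).trans (by gcongr)
    rw [div_lt_iff₀ hnn]
    linarith
  have hlt : coverEntropyEntourage T₀ F U < (ε : EReal) :=
    (hle.trans hdiv).trans_lt (EReal.coe_lt_coe_iff.2 hreal)
  exact absurd (hεh.trans hlt) (lt_irrefl _)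

/-- **Few windows ⇒ the orbit closure is a zero-entropy system.**  Under the hypothesis of
`coverEntropyEntourage_cylinder_le_zero`, the topological (cover) entropy of the shift on the orbit
closure of the Liouville sign sequence is `0` (the cylinder relations are a base of the product
uniformity, `exists_cylinderRel_subset`). [folklore] -/
theorem coverEntropy_orbitClosure_eq_zero
    (h : ∀ η : ℝ, 0 < η → ∀ L₀ : ℕ, ∃ L : ℕ, L₀ ≤ L ∧ ∃ S : Finset (Fin L → Bool),
      (∀ m : ℕ, (fun j : Fin L => decide (liouville (m + j) = 1)) ∈ S) ∧
        (S.card : ℝ) < (2 : ℝ) ^ (η * L)) :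
    coverEntropy (fun (z : ℕ → Bool) (j : ℕ) => z (j + 1))
      (closure (Set.range fun m : ℕ => fun i : ℕ => decide (liouville (m + i) = 1))) = 0 := by
  apply le_antisymm
  · refine iSup₂_le fun U hU => ?_
    obtain ⟨k, hk⟩ := exists_cylinderRel_subset hU
    exact (coverEntropyEntourage_antitone _ _ hk).trans (coverEntropyEntourage_cylinder_le_zero k h)
  · exact coverEntropy_nonneg _ ⟨_, subset_closure ⟨0, rfl⟩⟩

/-! ### §3 Sarnak's conjecture ⇒ positive pattern entropy ⇒ the crux -/

/-- ★ **Sarnak's conjecture implies that `λ` has positive sign-pattern entropy.**  If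
`SarnakConjecture` (Möbius disjointness from zero-entropy systems) holds, then there is `η > 0` such
that for all large `L` the Liouville sequence shows at least `2^{η L}` distinct sign patterns
`(λ(m+1), …, λ(m+L))`.  Otherwise §2 makes the orbit closure of the sign sequence `x_λ` under the
one-sided shift a compact metric zero-entropy system, and Möbius disjointness at the point `x_λ` with the
observable `y ↦ ±1` (sign of `y 0`) gives `(1/N) Σ_{n<N} μ(n) λ(n) → 0`, whereas
`μ(n) λ(n) = μ(n)² = 𝟙[n squarefree]` has density `6/π²` (Hardy–Wright Thm 333). [folklore] -/
theorem patternEntropy_of_sarnak (hS : Literature.NumberTheory.Sieve.SarnakConjecture) :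
    ∃ η : ℝ, 0 < η ∧ ∃ L₀ : ℕ, ∀ L : ℕ, L₀ ≤ L → ∃ M : ℕ, (2 : ℝ) ^ (η * L) ≤
      ((range M).image fun m : ℕ => fun j : Fin L => (liouville (m + j + 1) : ℤ)).card := by
  classical
  by_contra hneg
  push Not at hneg
  -- (i) the covering form of the hypothesis of §2
  have hcov : ∀ η : ℝ, 0 < η → ∀ L₀ : ℕ, ∃ L : ℕ, L₀ ≤ L ∧ ∃ S : Finset (Fin L → Bool),
      (∀ m : ℕ, (fun j : Fin L => decide (liouville (m + j) = 1)) ∈ S) ∧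
        (S.card : ℝ) < (2 : ℝ) ^ (η * L) := by
    intro η hη L₀
    obtain ⟨L₁, hL₁⟩ := exists_nat_ge (2 / η)
    obtain ⟨L, hL, hM⟩ := hneg (η / 2) (by positivity) (max L₀ L₁)
    have hfin : (Set.range fun m : ℕ => fun j : Fin L => decide (liouville (m + j) = 1)).Finite :=
      Set.toFinite _
    refine ⟨L, le_trans (le_max_left _ _) hL, hfin.toFinset,
      fun m => hfin.mem_toFinset.mpr ⟨m, rfl⟩, ?_⟩
    have hwit : ∀ w ∈ hfin.toFinset, ∃ m : ℕ,
        (fun j : Fin L => decide (liouville (m + j) = 1)) = w :=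
      fun w hw => hfin.mem_toFinset.mp hw
    choose! mw hmw using hwit
    set M : ℕ := hfin.toFinset.sup mw + 1
    have hsub : hfin.toFinset ⊆ insert (fun j : Fin L => decide (liouville (0 + j) = 1))
        (((range M).image fun m : ℕ => fun j : Fin L => (liouville (m + j + 1) : ℤ)).image
          fun v : Fin L → ℤ => fun j => decide (v j = 1)) := by
      intro w hw
      have hmle : mw w ≤ hfin.toFinset.sup mw := Finset.le_sup hw
      rw [Finset.mem_insert]
      rcases Nat.eq_zero_or_pos (mw w) with h0 | hpos
      · left; rw [← hmw w hw, h0]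
      · right
        refine Finset.mem_image.mpr ⟨fun j : Fin L => (liouville (mw w - 1 + j + 1) : ℤ),
          Finset.mem_image.mpr ⟨mw w - 1, Finset.mem_range.mpr (by omega), rfl⟩, ?_⟩
        funext j
        have hwj := congrFun (hmw w hw) j
        have hidx : mw w - 1 + (j : ℕ) + 1 = mw w + j := by omega
        simp only [hidx, ← hwj]
    have hcardle : hfin.toFinset.card ≤
        1 + ((range M).image fun m : ℕ => fun j : Fin L => (liouville (m + j + 1) : ℤ)).card := by
      have h1 := Finset.card_le_card hsub
      have h2 := Finset.card_insert_le (fun j : Fin L => decide (liouville (0 + j) = 1))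
        ((((range M).image fun m : ℕ => fun j : Fin L => (liouville (m + j + 1) : ℤ)).image
          fun v : Fin L → ℤ => fun j => decide (v j = 1)))
      have h3 : ((((range M).image fun m : ℕ => fun j : Fin L => (liouville (m + j + 1) : ℤ)).image
          fun v : Fin L → ℤ => fun j => decide (v j = 1))).card ≤
          ((range M).image fun m : ℕ => fun j : Fin L => (liouville (m + j + 1) : ℤ)).card :=
        Finset.card_image_le
      omega
    have hMlt := hM M
    -- `#S ≤ 1 + c < 1 + A ≤ A · A = 2^{η L}` with `A = 2^{(η/2) L} ≥ 2`
    set A : ℝ := (2 : ℝ) ^ (η / 2 * (L : ℝ)) with hA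
    have hA2 : (2 : ℝ) ≤ A := by
      have hexp : (1 : ℝ) ≤ η / 2 * (L : ℝ) := by
        have hL₁L : (L₁ : ℝ) ≤ L := by exact_mod_cast le_trans (le_max_right _ _) hL
        have h1 : 2 / η ≤ (L : ℝ) := hL₁.trans hL₁L
        rw [div_le_iff₀ hη] at h1
        linarith
      calc (2 : ℝ) = (2 : ℝ) ^ (1 : ℝ) := (Real.rpow_one 2).symm
        _ ≤ A := Real.rpow_le_rpow_of_exponent_le one_le_two hexp
    have hAA : (2 : ℝ) ^ (η * (L : ℝ)) = A * A := by
      rw [hA, ← Real.rpow_add two_pos]; ring_nf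
    have hc : (hfin.toFinset.card : ℝ) ≤
        1 + (((range M).image fun m : ℕ => fun j : Fin L => (liouville (m + j + 1) : ℤ)).card : ℝ) := by
      exact_mod_cast hcardle
    rw [hAA]
    nlinarith [hc, hMlt, hA2]
  -- (ii) zero entropy of the orbit closure
  have h0 := coverEntropy_orbitClosure_eq_zero hcov
  -- (iii) Sarnak's conjecture on the compact metric system `(F, T)`
  letI : MetricSpace (ℕ → Bool) := PiNat.metricSpaceOfDiscreteUniformity (fun _ => rfl)
  set F : Set (ℕ → Bool) := closure (Set.range fun m : ℕ => fun i : ℕ => decide (liouville (m + i) = 1))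
  haveI : CompactSpace F := isCompact_iff_compactSpace.mp isClosed_closure.isCompact
  have hmaps : Set.MapsTo (fun (z : ℕ → Bool) (j : ℕ) => z (j + 1)) F F := mapsTo_shift_orbitClosure
  set T : F → F := hmaps.restrict _ F F with hT
  have hTc : Continuous T :=
    (continuous_pi fun j => continuous_apply (j + 1)).restrict hmaps
  have h0' : coverEntropy T Set.univ = 0 := by
    rw [hT, coverEntropy_restrict hmaps]; exact h0
  have hfcont : Continuous fun y : F => (if y.1 0 then (1 : ℂ) else -1) := by
    have h1 : Continuous fun y : F => y.1 0 := (continuous_apply 0).comp continuous_subtype_val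
    exact (continuous_of_discreteTopology (f := fun b : Bool => if b then (1 : ℂ) else -1)).comp h1
  let f : C(F, ℂ) := ⟨fun y => if y.1 0 then (1 : ℂ) else -1, hfcont⟩
  have hx₀ : (fun i : ℕ => decide (liouville (0 + i) = 1)) ∈ F := subset_closure ⟨0, rfl⟩
  have hlim := hS F T hTc h0' f ⟨_, hx₀⟩
  -- the summands are `μ(n) λ(n) = 𝟙[n squarefree]`
  have hterm : ∀ n : ℕ, (μ n : ℂ) * f (T^[n] ⟨_, hx₀⟩) = if Squarefree n then (1 : ℂ) else 0 := by
    intro n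
    have hval : ((T^[n] ⟨_, hx₀⟩ : F) : ℕ → Bool) =
        (fun (z : ℕ → Bool) (j : ℕ) => z (j + 1))^[n] (fun i : ℕ => decide (liouville (0 + i) = 1)) :=
      hmaps.coe_iterate_restrict ⟨_, hx₀⟩ n
    have hf : f (T^[n] ⟨_, hx₀⟩) = if decide (liouville n = 1) then (1 : ℂ) else -1 := by
      show (if ((T^[n] ⟨_, hx₀⟩ : F) : ℕ → Bool) 0 then (1 : ℂ) else -1) = _
      rw [hval, shift_iterate_apply, Nat.zero_add, Nat.zero_add]
    rw [hf]
    by_cases hsq : Squarefree n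
    · have hn0 : n ≠ 0 := hsq.ne_zero
      rw [if_pos hsq, ArithmeticFunction.moebius_apply_of_squarefree hsq, liouville_apply hn0]
      rcases neg_one_pow_eq_or ℤ (cardFactors n) with h1 | h1 <;> simp [h1]
    · rw [if_neg hsq, ArithmeticFunction.moebius_eq_zero_of_not_squarefree hsq]; simp
  have hsum : ∀ N : ℕ, ∑ n ∈ range N, (μ n : ℂ) * f (T^[n] ⟨_, hx₀⟩) =
      (((range N).filter Squarefree).card : ℂ) := by
    intro N
    simp_rw [hterm]
    rw [Finset.sum_ite, Finset.sum_const_zero, add_zero, Finset.sum_const, nsmul_eq_mul, mul_one]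
  simp_rw [hsum] at hlim
  -- the squarefree numbers have density `6/π²`, contradiction
  have hQ : ∀ N : ℕ, 1 ≤ N → (range N).filter Squarefree = (Icc 1 (N - 1)).filter Squarefree := by
    intro N hN
    ext n
    simp only [Finset.mem_filter, Finset.mem_range, Finset.mem_Icc]
    constructor
    · rintro ⟨h1, h2⟩; exact ⟨⟨Nat.pos_of_ne_zero h2.ne_zero, by omega⟩, h2⟩
    · rintro ⟨⟨h1, h2⟩, h3⟩; exact ⟨by omega, h3⟩
  have hdens := Literature.NumberTheory.Multiplicative.SquarefreeDensity.thm333_density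
  have hdens' : Tendsto (fun N : ℕ => ((((Icc 1 (N - 1)).filter Squarefree).card : ℝ) / ((N - 1 : ℕ) : ℝ))
      * (((N - 1 : ℕ) : ℝ) / N)) atTop (𝓝 (6 / Real.pi ^ 2 * 1)) := by
    refine (hdens.comp (tendsto_sub_atTop_nat 1)).mul ?_
    have h1 : Tendsto (fun N : ℕ => (1 : ℝ) - 1 / N) atTop (𝓝 (1 - 0)) :=
      tendsto_const_nhds.sub (tendsto_const_div_atTop_nhds_zero_nat 1)
    rw [sub_zero] at h1
    refine h1.congr' ?_
    filter_upwards [eventually_ge_atTop 1] with N hN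
    have hN' : (N : ℝ) ≠ 0 := by positivity
    rw [Nat.cast_sub hN, Nat.cast_one]
    field_simp
  have hnorm : Tendsto (fun N : ℕ => ((((range N).filter Squarefree).card : ℝ)) / N) atTop (𝓝 0) := by
    have := hlim.norm
    rw [norm_zero] at this
    refine this.congr' ?_
    filter_upwards [eventually_ge_atTop 1] with N hN
    rw [norm_mul, norm_inv, Complex.norm_natCast, Complex.norm_natCast, inv_mul_eq_div]
  have hsame : Tendsto (fun N : ℕ => ((((range N).filter Squarefree).card : ℝ)) / N) atTop
      (𝓝 (6 / Real.pi ^ 2 * 1)) := by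
    refine hdens'.congr' ?_
    filter_upwards [eventually_ge_atTop 2] with N hN
    rw [hQ N (by omega)]
    have hN1 : ((N - 1 : ℕ) : ℝ) ≠ 0 := by
      rw [Nat.cast_sub (by omega), Nat.cast_one]
      have : (2 : ℝ) ≤ N := by exact_mod_cast hN
      linarith
    have hN' : (N : ℝ) ≠ 0 := by positivity
    field_simp
  have heq := tendsto_nhds_unique hsame hnorm
  have hpi : (0 : ℝ) < 6 / Real.pi ^ 2 * 1 := by positivity
  linarith

/-- ★★ **Sarnak's conjecture implies the crux `LiouvilleCutRank`.**  Möbius disjointness from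
zero-entropy systems (`Literature.NumberTheory.Sieve.SarnakConjecture`) forces positive sign-pattern entropy of
the Liouville sequence (`patternEntropy_of_sarnak`), hence — by the entropy criterion
`BlockEntropy.liouvilleCutRank_of_patternEntropy` — for every `W`, eventually every balanced digital cut
matrix `(λ(N_π(r, c) + 1))_{r,c}` has rank `≥ W`.  A conditional bridge strictly below the tree's
Chowla ⇒ crux (`sarnakConjecture_of_moebiusChowlaConjecture_holds`). [folklore] -/
theorem liouvilleCutRank_of_sarnak (hS : Literature.NumberTheory.Sieve.SarnakConjecture) :
    LiouvilleCutRank :=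
  liouvilleCutRank_of_patternEntropy (patternEntropy_of_sarnak hS)

end Summit.ValiantsHypothesis.ValiantsHypothesis.Theorems.LiouvilleSarnakLiouvilleCutRank.SarnakBridge
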